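import Summits.BirchSwinnertonDyer.BirchSwinnertonDyer.Theorems.ClassRecordThreeEulerHalvesAtThreeWalkSupplyDuality
import Summits.BirchSwinnertonDyer.BirchSwinnertonDyer.Theorems.ClassRecordThreeEulerHalvesAtThreeWalkSupplyCarrierPackage
import Summits.BirchSwinnertonDyer.BirchSwinnertonDyer.Theorems.ClassRecordThreeEulerHalvesAtThreeWalkSupplyPT
import Summits.BirchSwinnertonDyer.BirchSwinnertonDyer.Theorems.ClassRecordThreeEulerHalvesAtThreeWalkSupplySelmer
import Summits.BirchSwinnertonDyer.BirchSwinnertonDyer.Theorems.ClassRecordThreeEulerHalvesAtThreeWalkSupplyAtThreeSelmer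
import Summits.BirchSwinnertonDyer.BirchSwinnertonDyer.Theorems.Rank1ResidualJetKodairaNeronCyclic
import Summits.BirchSwinnertonDyer.BirchSwinnertonDyer.Theorems.Rank1ResidualJetKolyvaginLocalTermClosed
import Summits.BirchSwinnertonDyer.Rank1Residual.JET.RingClassTransverseLagrangian
import Summits.BirchSwinnertonDyer.Rank1Residual.JET.TransverseFamilyConjAct
import Summits.BirchSwinnertonDyer.BirchSwinnertonDyer.Theorems.ClassRecordThreeEulerHalvesAtThreeWalkSupplyDisjoint
import Summits.BirchSwinnertonDyer.BirchSwinnertonDyer.Theorems.ClassRecordThreeEulerHalvesAtThreeWalkSupplyRootTransverse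
import Summits.BirchSwinnertonDyer.BirchSwinnertonDyer.Theorems.Rank1ResidualJetRingClassFields
import HarnessLib

/-!
# The per-frame SELMER SUPPLY of the kernel walk at `p = 3` (registered stub `stub_supplyAtThree`, v2,
# VERBATIM) from FOUR closed statements — two cite-only named facts (Poitou–Tate, [GZ86 III (3.1)]) and
# bsd-jet's two completion-layer KERNEL GAPS `htr`, `h49str` IN THEIR EXACT END-FORM SHAPES (cell
# `bsd-stepL`, seat `bsd-stepL-tam3-p1`, helper toward item 19109 `EulerHalvesAtThree`)

HONEST FRAMING. Nothing here proves BSD, J₃ or the divisibility of any Heegner point; the registered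
stub `stub_supplyAtThree` holds ONLY modulo the hypotheses below; no item closes; 0 classes move (T7);
`--supports stmt-BirchSwinnertonDyer-19109` (helper).

WHAT THIS FILE DOES. `selmerSupplyAtThree_of_bsdjetGaps : hPT → hGZ → htr → h49str → ‹hsupply of
Koly.jetchevMaxHLAtThree_of_facts_of_selmerSupply VERBATIM›` — `selmerSupplyAtThree_of_kernelGaps`
(p532334) with (i) `hRCF` DISCHARGED (bsd-jet `JET.numberField_ringClassField`) and (ii) the ROOT form
of `htr` REPLACED by bsd-jet's own END-FORM `htr` (classes `c_k(P_c)` in `transverseKer`, Howard 2004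
Lemma 2.7.3), used one level up through `Walk.rootClass_mem_selmerGroup_selmerF_of_levelUp`
(`…WalkSupplyRootTransverse`: `ι_* c_k(Q) = c_{k+u}(P_s)`, corner-p1's cartesian transverse condition,
pv-1's decomposition-trivial lemma). What is LEFT — the COMPLETE residual of this seat's road to
`stub_jetchevMaxHLAtThree` besides the seven typed print facts: `hPT` (`poitouTate_selmerStructure_duality_conj`,
cite-only), `hGZ` ([GZ86 III (3.1)] receptacle schema, cite-only), and bsd-jet road K's two
completion-layer KERNEL GAPS `htr`, `h49str` VERBATIM. NO core-vertex binder (their K5), no local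
print-to-type hypothesis, no supply hypothesis: the two programmes' residuals now COINCIDE except for K5.
References (locators only; no cited FACT is declared): [cite: Jetchev2008, §3.1 item 7, §3.1.2,
§4.2, Prop. 4.5–4.9, Thm. 5.1, Lemma 5.2, Prop. 6.4 (pp. 814–824)] [cite: GrossLMS1991, §3, Prop. 6.2
(1)] [cite: GrossZagier1986, III (3.1)] [cite: Howard2004HeegnerKolyvagin, Prop. 2.1.7, 2.1.9, Lemma
2.7.3] [cite: MazurRubin2004, Lemma 1.2.4] [cite: MilneADT2006, Ch. I, Cor. 3.4, Thm. 4.10(b)].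
Design: one theorem, no definitions; `K : Type`. Axioms: `propext`, `Classical.choice`, `Quot.sound`.
-/

set_option autoImplicit false

noncomputable section

open scoped Classical NumberField Pointwise

namespace Summit.BirchSwinnertonDyer.Rank1Residual.X11b.Three.Koly

open WeierstrassCurve IsDedekindDomain NumberField Field Literature.NumberTheory.EllipticCurves
  Literature.NumberTheory.EllipticCurves.ModularForms Literature.NumberTheory.EllipticCurves.Jetchev2008
  Literature.NumberTheory.EllipticCurves.KolyvaginCocycle
  Literature.NumberTheory.EllipticCurves.Rank1Residual Literature.NumberTheory.GaloisRepresentations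
  Literature.NumberTheory.GaloisRepresentations.DiscreteGaloisModule
  Literature.NumberTheory.GaloisCohomology Literature.NumberTheory.Automorphic
  Summit.BirchSwinnertonDyer.Rank1Residual.X11b Summit.BirchSwinnertonDyer.Rank1Residual.JET
  Summit.BirchSwinnertonDyer.Rank1Residual.JET.SelmerVocabulary
  Summit.BirchSwinnertonDyer.Rank1Residual.JET.Walk

-- four ∀-closed hypotheses and a nine-conjunct ∃-conclusion: binder elaboration exceeds the default
set_option maxHeartbeats 800000 in
/-- **The registered stub `stub_supplyAtThree` (v2) VERBATIM, from `hPT`, `hGZ` and bsd-jet's kernel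
gaps `htr`, `h49str` in their END-FORM shapes** — see the module docstring. [cite: Jetchev2008, §3.1 item 7, §4.2,
Prop. 4.5–4.9, Thm. 5.1, Lemma 5.2 (pp. 814–823)] [cite: GrossZagier1986, III (3.1)]
[cite: Howard2004HeegnerKolyvagin, Prop. 2.1.9, Lemma 2.7.3] [cite: MilneADT2006, Ch. I, Thm. 4.10(b)] -/
theorem selmerSupplyAtThree_of_bsdjetGaps
    -- NAMED PRINT (cite-only)
    (hPT : ∀ (K : Type) [Field K] [NumberField K], poitouTate_selmerStructure_duality_conj K)
    (hGZ : ∀ (W : WeierstrassCurve ℚ) [W.IsElliptic] [NeZero (W.conductorNorm ℤ)]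
      (K : Type) [Field K] [NumberField K] (p : ℕ) [Fact p.Prime]
      (Dt : ModularParametrizationData W (W.conductorNorm ℤ)) (β : ℤ) (ι : K →+* ℂ)
      [∀ j : ℕ, NumberField (ringClassField K ι j)],
      ∃ n' : ℤ, IsCoprime (p : ℤ) n' ∧ ∀ (m : ℕ) (dm : KolyvaginHeegnerData Dt β ι m)
        (γ : ringClassField K ι m ≃ₐ[ℚ] ringClassField K ι m), γ ∈ ringClassGal ι m →
        ∀ v : HeightOneSpectrum (𝓞 K), ¬ (W.baseChange K).HasGoodReductionAt v →
          n' • pointsMap (W.baseChange K) (v.adicCompletion K)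
              (dm.toGeomPoints (pointGalHom W (ringClassField K ι m) γ dm.y)) ∈
            E0Receptacle (W.baseChange K) v ∧
          ∀ (ℓ : ℕ), ℓ ∈ m.primeFactors → ∀ (dm' : KolyvaginHeegnerData Dt β ι (m / ℓ))
            (hle : ringClassField K ι (m / ℓ) ≤ ringClassField K ι m),
            n' • pointsMap (W.baseChange K) (v.adicCompletion K)
                (dm.toGeomPoints (pointGalHom W (ringClassField K ι m) γ
                  (WeierstrassCurve.Affine.Point.map (W' := W)
                    ((RingClassField.inclusion ι hle).restrictScalars ℚ) dm'.y))) ∈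
              E0Receptacle (W.baseChange K) v)
    -- the completion-layer KERNEL GAPS
    (htr : ∀ (W : WeierstrassCurve ℚ) [W.IsElliptic] [W.IsGloballyMinimal] [NeZero (W.conductorNorm ℤ)]
      (K : Type) [Field K] [NumberField K], IsImaginaryQuadratic K →
      ∀ (p : ℕ) [Fact p.Prime], p ≠ 2 →
      ∀ (Dt : ModularParametrizationData W (W.conductorNorm ℤ)) (β : ℤ) (ι : K →+* ℂ)
        [∀ j : ℕ, NumberField (ringClassField K ι j)]
        (k : ℕ) (c : ℕ), Squarefree c →
        (∀ ℓ ∈ c.primeFactors, Zhang2014.IsKolyvaginPrime (W.conductorNorm ℤ) W K p ℓ ∧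
          k ≤ Zhang2014.kolyvaginIndex W p ℓ) →
      ∀ (d : KolyvaginHeegnerData Dt β ι c), ∀ ℓ ∈ c.primeFactors,
        (d.kolyvaginClass (Fact.out : p.Prime) k :
          galoisCohomology ((W.baseChange K).torsionGaloisModule ((p ^ k : ℕ) : ℤ)) 1) ∈
          transverseKer W K ι ((p ^ k : ℕ) : ℤ) ℓ)
    (h49str : ∀ (W : WeierstrassCurve ℚ) [W.IsElliptic] [W.IsGloballyMinimal] [NeZero (W.conductorNorm ℤ)]
      (K : Type) [Field K] [NumberField K], IsImaginaryQuadratic K →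
      SatisfiesHeegnerHypothesis (W.conductorNorm ℤ) K →
      ∀ (p : ℕ) [Fact p.Prime], p ≠ 2 →
      ∀ (Dt : ModularParametrizationData W (W.conductorNorm ℤ)) (β : ℤ) (ι : K →+* ℂ)
        [∀ j : ℕ, NumberField (ringClassField K ι j)]
        (k : ℕ) (hn : ((p ^ k : ℕ) : ℤ) ≠ 0) (c : ℕ), Squarefree c →
        (∀ ℓ ∈ c.primeFactors, Zhang2014.IsKolyvaginPrime (W.conductorNorm ℤ) W K p ℓ ∧
          k ≤ Zhang2014.kolyvaginIndex W p ℓ) →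
      ∀ (q : HeightOneSpectrum (𝓞 K)), ((W.conductorNorm ℤ : ℕ) : 𝓞 K) ∈ q.asIdeal →
      ∀ (ℓ : ℕ), Zhang2014.IsKolyvaginPrime (W.conductorNorm ℤ) W K p ℓ →
        k ≤ Zhang2014.kolyvaginIndex W p ℓ → ℓ ∉ c.primeFactors →
      ∀ (d' : KolyvaginHeegnerData Dt β ι (c * ℓ)),
        galoisCohomology.localization ((W.baseChange K).torsionGaloisModule ((p ^ k : ℕ) : ℤ))
            (Sum.inr q) 1 (d'.kolyvaginClass (Fact.out : p.Prime) k) ∈ stringentFamily W K hn (Sum.inr q)) :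
    ∀ (W : WeierstrassCurve ℚ) [W.IsElliptic] [W.IsGloballyMinimal] [NeZero (W.conductorNorm ℤ)]
      (K : Type) [Field K] [NumberField K]
      (Dt : ModularParametrizationData W (W.conductorNorm ℤ)) (β : ℤ) (ι : K →+* ℂ),
      W.analyticRank = 1 → W.HasMultiplicativeReductionAtPrime 3 → Surj W 3 →
      IsImaginaryQuadratic K → SatisfiesHeegnerHypothesis (W.conductorNorm ℤ) K →
      Odd (NumberField.discr K) → (W.quadraticTwist (NumberField.discr K : ℚ)).entireLFunction 1 ≠ 0 →
      (4 * (W.conductorNorm ℤ : ℤ)) ∣ β ^ 2 - NumberField.discr K → ¬ (3 : ℤ) ∣ Dt.c →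
      ∀ (τ : K ≃ₐ[ℚ] K), τ ≠ 1 → ∀ (v : HeightOneSpectrum (𝓞 ℚ)) (k : ℕ), 1 ≤ k →
        padicValNat 3 (W.tamagawaNumberAt v) ≤ k →
      ∀ (n : ℕ) (d : KolyvaginHeegnerData Dt β ι n) (hn : Squarefree n ∧ ∀ q ∈ n.primeFactors,
        Zhang2014.IsKolyvaginPrime (W.conductorNorm ℤ) W K 3 q ∧ k ≤ Zhang2014.kolyvaginIndex W 3 q),
      ∀ (D : ∀ s : {m : ℕ // Squarefree m ∧ ∀ q ∈ m.primeFactors,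
        Zhang2014.IsKolyvaginPrime (W.conductorNorm ℤ) W K 3 q ∧ k ≤ Zhang2014.kolyvaginIndex W 3 q},
          KolyvaginHeegnerData Dt β ι s.1), D ⟨n, hn⟩ = d →
      ∀ (ε : ℤ), (ε = 1 ∨ ε = -1) → ∀ (eb : ℕ → Bool),
        (∀ (m ℓ : ℕ), ℓ.Prime → ¬ ℓ ∣ m → eb (m * ℓ) = !eb m) →
        (∀ m, (if eb m then (1 : ℤ) else -1) = ε * (-1) ^ m.primeFactors.card) →
      ∃ (𝒯 𝒮 : SelmerStructure ((W.baseChange K).torsionGaloisModule ((3 ^ k : ℕ) : ℤ)))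
        (Qcar : Finset (HeightOneSpectrum (𝓞 K)))
        (C' : ℕ → AddSubgroup (galoisCohomology ((W.baseChange K).torsionGaloisModule ((3 ^ k : ℕ) : ℤ)) 1)),
        (∀ v, 𝒮 v ≤ (W.baseChange K).kummerSelmerStructure ((3 ^ k : ℕ) : ℤ) v) ∧
        (∀ v ∈ Qcar, ((W.conductorNorm ℤ : ℕ) : 𝓞 K) ∈ v.asIdeal) ∧
        (∀ (ℓ : ℕ), Zhang2014.IsKolyvaginPrime (W.conductorNorm ℤ) W K 3 ℓ →
      k ≤ Zhang2014.kolyvaginIndex W 3 ℓ → ¬ ℓ ∣ n → ∀ v : HeightOneSpectrum (𝓞 K), (ℓ : 𝓞 K) ∈ v.asIdeal →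
      Disjoint ((W.baseChange K).kummerSelmerStructure ((3 ^ k : ℕ) : ℤ) (Sum.inr v)) (𝒯 (Sum.inr v))) ∧
        (∀ (s : {m : ℕ // Squarefree m ∧ ∀ q ∈ m.primeFactors,
        Zhang2014.IsKolyvaginPrime (W.conductorNorm ℤ) W K 3 q ∧ k ≤ Zhang2014.kolyvaginIndex W 3 q})
      (ℓ : ℕ), Zhang2014.IsKolyvaginPrime (W.conductorNorm ℤ) W K 3 ℓ →
      k ≤ Zhang2014.kolyvaginIndex W 3 ℓ → ¬ ℓ ∣ s.1 → (∀ q ∈ s.1.primeFactors, q < ℓ) → n ∣ s.1 →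
      ∀ v : HeightOneSpectrum (𝓞 K), (ℓ : 𝓞 K) ∈ v.asIdeal → ∀ b : Bool,
      Nat.card ((signPart W K τ ((3 ^ k : ℕ) : ℤ) (if b then 1 else -1)
          ((selmerF W ((3 ^ k : ℕ) : ℤ) 𝒯 (placesDividing K s.1)).relaxedAt {v}).selmerGroup).map
        (galoisCohomology.localization ((W.baseChange K).torsionGaloisModule ((3 ^ k : ℕ) : ℤ))
          (Sum.inr v) 1)) = 3 ^ k) ∧
        (∀ s (u : ℕ) (Q : (W.baseChange (ringClassField K ι s.1)).toAffine.Point)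
      (hAk : IsAdmissible (absoluteGaloisGroup K) (D s).pointsSubgroup ((3 ^ k : ℕ) : ℤ))
      (hQ : (D s).toGeomPoints Q ∈ invPoints (absoluteGaloisGroup K) (D s).pointsSubgroup ((3 ^ k : ℕ) : ℤ)),
      ((3 ^ u : ℕ) : ℤ) • Q = (D s).derivedPoint →
      (¬ ∃ Q' : (W.baseChange (ringClassField K ι s.1)).toAffine.Point,
        ((3 ^ (u + 1) : ℕ) : ℤ) • Q' = (D s).derivedPoint) →
      ((u + k : ℕ) : ℕ∞) ≤ Zhang2014.levelIndex W 3 s.1 →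
      (kolyvaginClass (W.baseChange K) ((3 ^ k : ℕ) : ℤ)
        ((W.baseChange K).zsmul_geomPoints_surjective_of_charZero
          (by exact_mod_cast pow_ne_zero k Nat.prime_three.ne_zero)) hAk ((D s).toGeomPoints Q) hQ :
          galoisCohomology ((W.baseChange K).torsionGaloisModule ((3 ^ k : ℕ) : ℤ)) 1) ∈
        (selmerF W ((3 ^ k : ℕ) : ℤ) 𝒯 (placesDividing K s.1)).selmerGroup) ∧
        (∀ m, C' m ≤ signPart W K τ ((3 ^ k : ℕ) : ℤ) (if !eb m then 1 else -1) ⊤) ∧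
        (∀ s : {m : ℕ // Squarefree m ∧ ∀ q ∈ m.primeFactors,
        Zhang2014.IsKolyvaginPrime (W.conductorNorm ℤ) W K 3 q ∧ k ≤ Zhang2014.kolyvaginIndex W 3 q},
      n ∣ s.1 → ∃ (Qg Qg' : Type) (_ : AddCommGroup Qg) (_ : AddCommGroup Qg') (_ : Finite Qg')
        (locq : signPart W K τ ((3 ^ k : ℕ) : ℤ) (if !eb s.1 then 1 else -1)
            (selmerF W ((3 ^ k : ℕ) : ℤ) 𝒯 (placesDividing K s.1)).selmerGroup →+ Qg)
        (locq' : C' s.1 →+ Qg'),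
        (∀ x : C' s.1, locq' x = 0 ↔
          (x : galoisCohomology ((W.baseChange K).torsionGaloisModule ((3 ^ k : ℕ) : ℤ)) 1) ∈
            signPart W K τ ((3 ^ k : ℕ) : ℤ) (if !eb s.1 then 1 else -1)
              (selmerF W ((3 ^ k : ℕ) : ℤ) 𝒯 (placesDividing K s.1)).selmerGroup) ∧
        Nat.card locq.range * Nat.card locq'.range = Nat.card Qg' ∧ IsAddCyclic Qg' ∧
        Nat.card Qg' = 3 ^ padicValNat 3 (W.tamagawaNumberAt v)) ∧
        (∀ (s s' : {m : ℕ // Squarefree m ∧ ∀ q ∈ m.primeFactors,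
        Zhang2014.IsKolyvaginPrime (W.conductorNorm ℤ) W K 3 q ∧ k ≤ Zhang2014.kolyvaginIndex W 3 q})
      (ℓ : ℕ), ℓ.Prime → ¬ ℓ ∣ s.1 → s'.1 = s.1 * ℓ → (∀ q ∈ s.1.primeFactors, q < ℓ) → n ∣ s.1 →
      ∀ v : HeightOneSpectrum (𝓞 K), (ℓ : 𝓞 K) ∈ v.asIdeal →
      ((D s').kolyvaginClass Nat.prime_three k :
          galoisCohomology ((W.baseChange K).torsionGaloisModule ((3 ^ k : ℕ) : ℤ)) 1) ∈
        (((selmerF0 W ((3 ^ k : ℕ) : ℤ) 𝒯 𝒮 (placesDividing K s.1) Qcar).relaxedAt {v}).selmerGroup)) ∧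
        (∀ (s : {m : ℕ // Squarefree m ∧ ∀ q ∈ m.primeFactors,
        Zhang2014.IsKolyvaginPrime (W.conductorNorm ℤ) W K 3 q ∧ k ≤ Zhang2014.kolyvaginIndex W 3 q})
      (ℓ : ℕ), Zhang2014.IsKolyvaginPrime (W.conductorNorm ℤ) W K 3 ℓ →
      k ≤ Zhang2014.kolyvaginIndex W 3 ℓ → ¬ ℓ ∣ s.1 → (∀ q ∈ s.1.primeFactors, q < ℓ) → n ∣ s.1 →
      ∀ v : HeightOneSpectrum (𝓞 K), (ℓ : 𝓞 K) ∈ v.asIdeal →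
      ∃ (Sg : Type) (_ : AddCommGroup Sg)
        (sing : signPart W K τ ((3 ^ k : ℕ) : ℤ) (if !eb s.1 then 1 else -1)
            (((selmerF0 W ((3 ^ k : ℕ) : ℤ) 𝒯 𝒮 (placesDividing K s.1) Qcar).relaxedAt {v}).selmerGroup)
          →+ Sg),
        (∀ x, sing x = 0 ↔
          (x : galoisCohomology ((W.baseChange K).torsionGaloisModule ((3 ^ k : ℕ) : ℤ)) 1) ∈
            signPart W K τ ((3 ^ k : ℕ) : ℤ) (if !eb s.1 then 1 else -1)
              ((selmerF0 W ((3 ^ k : ℕ) : ℤ) 𝒯 𝒮 (placesDividing K s.1) Qcar).selmerGroup)) ∧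
        Nat.card sing.range *
          Nat.card ((C' s.1).map (galoisCohomology.localization
            ((W.baseChange K).torsionGaloisModule ((3 ^ k : ℕ) : ℤ)) (Sum.inr v) 1)) = 3 ^ k) := by
  intro W _ _ _ K _ _ Dt β ι hr hmult hρ hK hHN hodd hLt hβ hc3 τ hτ v k hk htk n d hn D hDd ε hε eb heb hebε
  have hp : (3 : ℕ).Prime := Nat.prime_three
  haveI : Fact (3 : ℕ).Prime := ⟨hp⟩
  haveI hRCF' : ∀ j : ℕ, NumberField (ringClassField K ι j) := fun j ↦ numberField_ringClassField K hK ι j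
  have hp2 : (3 : ℕ) ≠ 2 := by norm_num
  have h3n : ((3 ^ k : ℕ) : ℤ) ≠ 0 := by exact_mod_cast pow_ne_zero k hp.ne_zero
  haveI : NeZero (3 ^ k) := ⟨pow_ne_zero k hp.ne_zero⟩
  haveI : Finite (geomTorsion (W.baseChange K) ((3 ^ k : ℕ) : ℤ)) :=
    finite_geomTorsion_of_neZero (W.baseChange K) (3 ^ k)
  -- frame facts: `(N, d_K) = 1`, `d_K < -4`, `3 ∣ N`, `τ² = 1`
  have hND : IsCoprime ((W.conductorNorm ℤ : ℕ) : ℤ) (NumberField.discr K) :=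
    KolyvaginAssembly.isCoprime_discr_of_satisfiesHeegnerHypothesis hK hHN
  have h3N : 3 ∣ W.conductorNorm ℤ := dvd_conductorNorm_of_mult (W := W) hmult
  have hD : NumberField.discr K < -4 := by
    have hneg : NumberField.discr K < 0 := hK.discr_neg
    have h3split : SatisfiesHeegnerHypothesis 3 K := SatisfiesHeegnerHypothesis.of_dvd h3N hHN
    have hpd : ¬ ((3 : ℕ) : ℤ) ∣ NumberField.discr K :=
      not_dvd_discr_of_split hK Nat.prime_three (by norm_num) h3split
    have hD3 : NumberField.discr K ≠ -3 := fun h ↦ hpd (h ▸ ⟨-1, by norm_num⟩)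
    have h4 : NumberField.discr K % 4 = 0 ∨ NumberField.discr K % 4 = 1 :=
      Literature.NumberTheory.QuadraticFields.Quadratic.discr_emod_four (K := K) hK.1
    obtain ⟨r, hr⟩ := hodd
    omega
  have hD3 : NumberField.discr K ≠ -3 := by omega
  have hD4 : NumberField.discr K ≠ -4 := by omega
  have hτ2 : τ * τ = 1 := algEquiv_mul_self_eq_one hK τ hτ
  -- admissible numbers are divisor-closed; the data system at the divisors of an admissible `s`
  have hadm : ∀ (s : {m : ℕ // Squarefree m ∧ ∀ q ∈ m.primeFactors,
      Zhang2014.IsKolyvaginPrime (W.conductorNorm ℤ) W K 3 q ∧ k ≤ Zhang2014.kolyvaginIndex W 3 q})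
      (m : ℕ), m ∣ s.1 → Squarefree m ∧ ∀ q ∈ m.primeFactors,
      Zhang2014.IsKolyvaginPrime (W.conductorNorm ℤ) W K 3 q ∧ k ≤ Zhang2014.kolyvaginIndex W 3 q :=
    fun s m hm ↦ ⟨s.2.1.squarefree_of_dvd hm,
      fun q hq ↦ s.2.2 q (Nat.primeFactors_mono hm s.2.1.ne_zero hq)⟩
  -- [GZ86 III (3.1)] at this frame
  obtain ⟨n', hcop', hGZ'⟩ := hGZ W K 3 Dt β ι
  -- the GLOBAL intrinsic transverse family at level `3^k`
  obtain ⟨𝒯, h𝒯, -⟩ := exists_globalTransverseFamily W ι ((3 ^ k : ℕ) : ℤ)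
  -- the transverse local facts for the global family at the places of every admissible conductor
  have h𝒯σ' : ∀ (s : {m : ℕ // Squarefree m ∧ ∀ q ∈ m.primeFactors,
        Zhang2014.IsKolyvaginPrime (W.conductorNorm ℤ) W K 3 q ∧ k ≤ Zhang2014.kolyvaginIndex W 3 q})
      (v w : HeightOneSpectrum (𝓞 K)) (h : τ • v = w), v ∈ placesDividing K s.1 →
      ∀ x : galoisCohomology (((W.baseChange K).torsionGaloisModule ((3 ^ k : ℕ) : ℤ)).toLocal
        (Sum.inr v : Place K)) 1,
      x ∈ 𝒯 (Sum.inr v) → conjActPlace W τ ((3 ^ k : ℕ) : ℤ) h x ∈ 𝒯 (Sum.inr w) :=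
    fun s v w h hv x hx ↦ globalTransverse_conjActPlace_mem h𝒯 τ s.2.1
      (forall_conjActPlace_mem_of_eq_iInf_transverseSubgroup W hK ι τ _ s.1) v w h hv x hx
  -- the carrier package: `𝒮`, the split place `v₀`, (δ) of order `3^t`, membership at the carrier
  obtain ⟨𝒮, v₀, hS, hv₀, hv₀N, hv₀N', h𝒮σ, hcyc, hidx, h𝒮mem⟩ :=
    exists_carrierPackage W K hK hD3 hD4 τ hτ hHN 3 hp2 h3N hρ Dt β ι hcop' hGZ'
      kodairaNeron_isAddCyclic_forall v k h3n htk
      (fun c hc hcK q hqN ℓ hℓK hkℓ hℓc d' ↦ h49str W K hK hHN 3 hp2 Dt β ι k h3n c hc hcK q hqN ℓ hℓK hkℓ hℓc d')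
  -- the duality conjuncts (bsd-jet Poitou–Tate packages; Weil datum and `τ² = 1` inside)
  obtain ⟨C', hC, hdual_q, hdual_ℓ⟩ := exists_dualityConjuncts_of_localFacts W (hPT K) hK ι τ hτ 3 k hp2
    hk h𝒯 (fun c _ _ 𝒯c h𝒯c ↦ forall_conjActPlace_mem_of_eq_iInf_transverseSubgroup W hK ι τ _ c 𝒯c h𝒯c)
    (fun c hc hcK 𝒯c h𝒯c e hμ hadd₁ hadd₂ hgal halt hnondeg inv hperf w hw ↦
      RingClassTransverse.dualTransported_eq_of_localTransverseFamily W K hK hD ι 3 hp2 k hk c hc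
        (fun ℓ hℓ ↦ (hcK ℓ hℓ).1) (fun ℓ hℓ ↦ (hcK ℓ hℓ).2) 𝒯c h𝒯c e hμ hadd₁ hadd₂ hgal halt hnondeg
        inv hperf w hw)
    (kolyvaginLocalTerm_of_poitouTate hPT W K hK τ hτ 3 k hp2 hk) eb n 𝒮 hS v₀ hv₀
    hv₀N h𝒮σ hcyc hidx
  refine ⟨𝒯, 𝒮, {v₀, τ • v₀}, C', hS, ?_, ?_, ?_, ?_, hC, hdual_q, ?_, hdual_ℓ⟩
  · -- hQcar
    intro q hq
    simp only [Finset.mem_insert, Finset.mem_singleton] at hq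
    rcases hq with rfl | rfl <;> assumption
  · -- hdisj ([J] §4.2 at one completion)
    intro ℓ hℓK hkℓ _ w hw
    exact globalTransverse_disjoint_kummer h𝒯
      (P := fun ℓ ↦ Zhang2014.IsKolyvaginPrime (W.conductorNorm ℤ) W K 3 ℓ ∧
        k ≤ Zhang2014.kolyvaginIndex W 3 ℓ)
      (fun ℓ hℓ w hw ↦ disjoint_kummer_iInf_transverseSubgroup W K hK hD ι k hℓ.1 w hw)
      (fun ℓ hℓ ↦ hℓ.1.1) ℓ ⟨hℓK, hkℓ⟩ w hw
  · -- hPT (Lemma 5.2 (iii), primal form)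
    intro s ℓ hℓK hkℓ hℓs _ _ w hw b
    obtain ⟨inv, hperf, hvan, -, hSC, hconj⟩ := hPT K (3 ^ k)
    have h2 : 2 ≤ 3 ^ k := le_trans (by norm_num) (Nat.pow_le_pow_right (by norm_num : 0 < 3) hk)
    obtain ⟨e, hμ, hadd₁, hadd₂, hgal, halt, hnondeg, hτe⟩ := exists_weilDatum_liftAut W τ (3 ^ k) h2
    have hs' : (if b then (1 : ℤ) else -1) = 1 ∨ (if b then (1 : ℤ) else -1) = -1 := by
      cases b <;> simp
    have hℓs' : ℓ ∉ s.1.primeFactors := fun h ↦ hℓs (Nat.dvd_of_mem_primeFactors h)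
    exact natCard_map_localization_signPart_relaxedAt W τ 3 k e hμ hadd₁ hadd₂ hgal halt hnondeg hτe
      hτ2 hp2 hk inv hperf hvan hSC (hconj τ) 𝒯 s.2.1.ne_zero (h𝒯σ' s)
      (globalTransverse_dualTransported_eq (ι := ι) h𝒯 s.2.1
        (fun 𝒯c h𝒯c inv' hperf' w' hw' ↦
          RingClassTransverse.dualTransported_eq_of_localTransverseFamily W K hK hD ι 3 hp2 k hk s.1 s.2.1
            (fun ℓ hℓ ↦ (s.2.2 ℓ hℓ).1) (fun ℓ hℓ ↦ (s.2.2 ℓ hℓ).2) 𝒯c h𝒯c e hμ hadd₁ hadd₂ hgal halt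
            hnondeg inv' hperf' w' hw')
        inv hperf)
      hs' (fun ℓ' h1 h2 _ v' hv' hfix ↦
        kolyvaginLocalTerm_of_poitouTate hPT W K hK τ hτ 3 k hp2 hk ℓ' h1 h2 v' hv' hfix _ hs')
      ℓ hℓK hkℓ hℓs' w hw
  · -- hselmer (root classes)
    intro s u Q hAk hQ hQP hndvd huk
    have hsKu : ∀ q ∈ s.1.primeFactors, Zhang2014.IsKolyvaginPrime (W.conductorNorm ℤ) W K 3 q ∧
        k + u ≤ Zhang2014.kolyvaginIndex W 3 q := fun q hq ↦
      ⟨(s.2.2 q hq).1, by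
        rw [Nat.add_comm]
        exact Zhang2014.natCast_le_levelIndex_iff.mp huk q hq⟩
    -- invariance of `[P_s]` mod `3^{k+u}` from the data at the divisors of `s`
    have hP : (D s).toGeomPoints (D s).derivedPoint ∈
        invPoints (absoluteGaloisGroup K) (D s).pointsSubgroup ((3 ^ (k + u) : ℕ) : ℤ) :=
      KolyCert.toGeomPoints_derivedPoint_mem_invPoints_of_dvd_zhang hK ι Dt hp hND hD s.2.1 hsKu
        (fun m hm ↦ D ⟨m, hadm s m hm⟩) s.1 dvd_rfl
    exact rootClass_mem_selmerGroup_selmerF_of_levelUp W h𝒯 hK hD3 hD4 hHN hp2 hρ hcop' hGZ' s.2.1 hsKu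
      (D s) Q hAk hQ hQP hP (htr W K hK 3 hp2 Dt β ι (k + u) s.1 s.2.1 hsKu (D s))
  · -- hsel0
    intro s s' ℓ hℓ hℓs hss' _ _ w hw
    have hs0 : s.1 ≠ 0 := s.2.1.ne_zero
    have hℓs' : ℓ ∈ s'.1.primeFactors := by
      rw [hss']; exact Nat.mem_primeFactors.mpr ⟨hℓ, dvd_mul_left ℓ s.1, mul_ne_zero hs0 hℓ.ne_zero⟩
    have hℓK : Zhang2014.IsKolyvaginPrime (W.conductorNorm ℤ) W K 3 ℓ := (s'.2.2 ℓ hℓs').1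
    have hkℓ : k ≤ Zhang2014.kolyvaginIndex W 3 ℓ := (s'.2.2 ℓ hℓs').2
    have hℓs'' : ℓ ∉ s.1.primeFactors := fun h ↦ hℓs (Nat.dvd_of_mem_primeFactors h)
    have htr' : ∀ q ∈ s.1.primeFactors,
        ((D s').kolyvaginClass (Fact.out : (3 : ℕ).Prime) k :
          galoisCohomology ((W.baseChange K).torsionGaloisModule ((3 ^ k : ℕ) : ℤ)) 1) ∈
          transverseKer W K ι ((3 ^ k : ℕ) : ℤ) q := fun q hq ↦
      htr W K hK 3 hp2 Dt β ι k s'.1 s'.2.1 s'.2.2 (D s') q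
        (by rw [hss']; exact Nat.primeFactors_mono (dvd_mul_right s.1 ℓ) (mul_ne_zero hs0 hℓ.ne_zero) hq)
    exact kolyvaginClass_mem_selmerGroup_selmerF0_relaxedAt W h𝒯 hK hD3 hD4 hHN hp2 hρ hcop' hGZ' 𝒮
      {v₀, τ • v₀} s.2.1 s.2.2 hℓK hkℓ hℓs hss' (D s') w hw htr'
      (fun q hq ↦ by
        have := h𝒮mem q hq s.1 s.2.1 s.2.2 ℓ hℓK hkℓ hℓs''
        rw [← hss'] at this
        exact this (D s'))

end Summit.BirchSwinnertonDyer.Rank1Residual.X11b.Three.Koly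

end
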